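import Summits.QuantumFields.YangMills.Theorems.FluctuationComparisonRegPrIntLS2BetaKPLogRep
import HarnessLib

/-!
# THE ATOM-GAS ⟹ BOND-GAS PUSHFORWARD DOOR: a hard-core gas over ATOM SETS (GREP's output; print's cube polymers) IS, under a cell map, a gas in the bond-polymer
# format `gasZ`∕`KPGasOn` of LINE g19-1∕g19-2 — locality, majorants, lengths, the KP inequality and the pinned size transported

Cell `ym3-torus` (YM ladder rung R3 = continuum `SU(2)` Yang–Mills on the three-torus — a RUNG, NOT d = 4, NOT infinite volume, NOT a mass gap, NOT Clay).
Width seat `ym3-torus-px20` (gen 15); `--supports stmt-QuantumFields-20520 --as helper`, count-neutral, definition-free, default heartbeats; registry v11.4 №36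
untouched.  Currency glue between the generic engine and the line's sockets (HOME/UV3-NODE.md §36.2): the Gaussian Battle–Brydges–Federbush polymer representation
(AnchorGap's GREP `stub_gaussianBBFPolymerRep`) and print's large-field gas ([Balaban1989LargeFieldII] (1.90)) are hard-core `polyInc` gases over ATOM SETS
`X : Finset β` (atoms = unit cubes), whereas GAS `BeyondOneLoopGasCan`, GAS₁, LFG and the sockets ✓`…LoopLedgerGasOfProductFormula`∕✓`…GasOfKPFamily` speak the
bond-polymer format: `Ξ(w_U) = polymerPartitionFunction polyInc (w U ·) univ` over `Finset (PBond P 0)` with the `KPGasOn` text.  Given a CELL MAP `blk : B → β`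
hitting every atom, the pushforward `X ↦ bs X := {b | blk b ∈ X}` is injective and preserves `polyInc` both ways; transporting activities by
`w U Y := K U (Y.image blk)` on images and `0` elsewhere:
* §1 `polymerPartitionFunction_eq_of_vanish_off` (GENERIC: activities vanishing off a sub-family do not change `Ξ`; lit ✓`polymerPartitionFunction_insert`);
  the cell-map geometry `bs`, `image_blk_bs`, `cellBonds_injective`, `polyInc_bs_iff`, `mem_range_bs_iff`.
* §2 ★ `gasZ_eq_atomGas` — `Ξ_bond(w_U) = Ξ_atom(K_U)` over any atom family `𝒜` closed under nothing (activities off `𝒜` are zero by definition of `w`)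
  (lit ✓`polymerPartitionFunction_image`).
* §3 `atomPush_empty`, `isLocalActivity_atomPush` — `w U ∅ = 0`; atom-locality of `K` ⟹ V-locality of `w` (the `IsLocalActivity` text).
* §4 ★★ `kpGasOn_of_atomKPGas` — atom-level data (majorant `K̄`, size `a ≥ 0`, lengths `ℓ ≥ 0` with the CELL-DIAMETER clause «`blk b, blk b′ ∈ X → tdist b.src b′.src ≤ ℓ X`»
  displayed as a hypothesis, the KP inequality `Σ_{X′ : X′ = X ∨ X′ ∩ X ≠ ∅} K̄ X′ e^{a X′ + κ ℓ X′} ≤ a X` for ALL atom sets `X`, pinned size `a {blk e} ≤ N`) ⟹ the `KPGasOn` TEXT of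
  LINE g19-1∕g19-2 VERBATIM for `w` on the window `W` at rate `κ` with one-bond size `N` (bond-side size `Y ↦ a (Y.image blk)`, lengths `Y ↦ ℓ (Y.image blk)`).

HONEST SCOPE.  [folklore] finite combinatorics over landed Literature lemmas; the atom-level data are HYPOTHESES; nothing of Bałaban's or of GREP is asserted or proved; GAS,
GAS₁, LFG, REP, H4ᶜ, S2β and `FluctuationComparisonRegPrIntL` (stmt-QuantumFields-20520) are NOT proved; no summit statement is proved by a helper; rung R3 = SU(2) YM₃ on
T³ — NOT d = 4, NOT infinite volume, NOT a mass gap, NOT Clay; the Yang–Mills mass gap is NOT proved.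

References: R. Kotecký, D. Preiss, CMP **103** (1986) 491–498 [KoteckyPreiss1986] ((1) p.492); T. Bałaban, CMP **122** (1989) 355–392 [Balaban1989LargeFieldII]
((1.90) p.388, (1.97)–(1.100) pp.389–390); D. C. Brydges, Les Houches 1984 [Brydges1986] (§3).
-/

set_option autoImplicit false

noncomputable section

open Finset
open Literature.Probability.LatticeModels
open Literature.MathematicalPhysics.QuantumFieldTheory.Balaban1983to89

namespace Summit.QuantumFields.YangMills.Theorems.LoopLedgerGasOfAtomGas

/-! ## §1 Generic: vanishing activities; the cell-map pushforward of atom sets -/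

section Vanish

variable {P : Type*} [DecidableEq P] {inc : P → P → Prop} [DecidableRel inc]

/-- Activities vanishing off a sub-family `Λ′ ⊆ Λ` do not change the partition function: `Ξ_Λ(z) = Ξ_{Λ′}(z)`. [folklore] -/
theorem polymerPartitionFunction_eq_of_vanish_off (hsymm : ∀ γ γ', inc γ γ' → inc γ' γ) (z : P → ℂ) {Λ Λ' : Finset P}
    (hsub : Λ' ⊆ Λ) (hz : ∀ γ ∈ Λ, γ ∉ Λ' → z γ = 0) :
    polymerPartitionFunction inc z Λ = polymerPartitionFunction inc z Λ' := by
  classical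
  -- induct on the finite set `Λ ∖ Λ'`
  suffices h : ∀ (D : Finset P), ∀ Λ, Λ' ⊆ Λ → Λ \ Λ' = D → (∀ γ ∈ Λ, γ ∉ Λ' → z γ = 0) →
      polymerPartitionFunction inc z Λ = polymerPartitionFunction inc z Λ' from h (Λ \ Λ') Λ hsub rfl hz
  intro D
  induction D using Finset.induction_on with
  | empty =>
    intro Λ hΛ hD _
    rw [Finset.sdiff_eq_empty_iff_subset] at hD
    rw [Finset.Subset.antisymm hD hΛ]
  | insert γ D hγD ih =>
    intro Λ hΛ hD hz
    have hγΛ : γ ∈ Λ ∧ γ ∉ Λ' := by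
      have : γ ∈ Λ \ Λ' := by rw [hD]; exact Finset.mem_insert_self γ D
      exact Finset.mem_sdiff.1 this
    rw [polymerPartitionFunction_eq_erase_add hsymm z hγΛ.1, hz γ hγΛ.1 hγΛ.2, zero_mul, add_zero]
    refine ih (Λ.erase γ) (fun x hx => Finset.mem_erase.2 ⟨fun h => hγΛ.2 (h ▸ hx), hΛ hx⟩) ?_
      (fun x hx hx' => hz x (Finset.mem_of_mem_erase hx) hx')
    rw [Finset.erase_sdiff_comm, hD, Finset.erase_insert hγD]

end Vanish

section CellMap

variable {B β : Type*} [Fintype B] [DecidableEq B] [DecidableEq β] (blk : B → β)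

omit [DecidableEq B] in
/-- The bonds of an atom set: `bs X = {b | blk b ∈ X}`. (Spelled inline everywhere: `univ.filter (fun b => blk b ∈ X)`.) [folklore] -/
theorem mem_cellBonds_iff (X : Finset β) (b : B) : b ∈ Finset.univ.filter (fun b => blk b ∈ X) ↔ blk b ∈ X := by
  simp

omit [DecidableEq B] in
/-- If every atom has a bond, the atoms of `bs X` are `X`. [folklore] -/
theorem image_blk_bs (hsurj : Function.Surjective blk) (X : Finset β) :
    (Finset.univ.filter (fun b => blk b ∈ X)).image blk = X := by
  ext a
  simp only [Finset.mem_image, Finset.mem_filter, Finset.mem_univ, true_and]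
  constructor
  · rintro ⟨b, hb, rfl⟩; exact hb
  · intro ha; obtain ⟨b, rfl⟩ := hsurj a; exact ⟨b, ha, rfl⟩

omit [DecidableEq B] in
/-- The pushforward of atom sets to bond sets is injective (every atom has a bond). [folklore] -/
theorem cellBonds_injective (hsurj : Function.Surjective blk) :
    Function.Injective (fun X : Finset β => Finset.univ.filter (fun b => blk b ∈ X)) := by
  intro X X' h
  have := congrArg (fun Y : Finset B => Y.image blk) h
  simpa only [image_blk_bs blk hsurj] using this

/-- The pushforward preserves «equal or overlapping» both ways. [folklore] -/
theorem polyInc_bs_iff (hsurj : Function.Surjective blk) (X X' : Finset β) :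
    polyInc (Finset.univ.filter (fun b => blk b ∈ X)) (Finset.univ.filter (fun b => blk b ∈ X')) ↔ polyInc X X' := by
  unfold polyInc
  constructor
  · rintro (h | ⟨b, hb⟩)
    · exact Or.inl (cellBonds_injective blk hsurj h)
    · rw [Finset.mem_inter, mem_cellBonds_iff, mem_cellBonds_iff] at hb
      exact Or.inr ⟨blk b, Finset.mem_inter.2 hb⟩
  · rintro (h | ⟨a, ha⟩)
    · exact Or.inl (h ▸ rfl)
    · obtain ⟨b, rfl⟩ := hsurj a
      rw [Finset.mem_inter] at ha
      exact Or.inr ⟨b, Finset.mem_inter.2 ⟨(mem_cellBonds_iff blk X b).2 ha.1, (mem_cellBonds_iff blk X' b).2 ha.2⟩⟩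

/-- A pushforward meets (or equals) a bond set iff the atom set meets (or equals) the bond set's atoms. [folklore] -/
theorem polyInc_bs_left_iff (hsurj : Function.Surjective blk) (X : Finset β) (Y : Finset B) :
    polyInc (Finset.univ.filter (fun b => blk b ∈ X)) Y ↔ polyInc X (Y.image blk) := by
  unfold polyInc
  constructor
  · rintro (h | ⟨b, hb⟩)
    · subst h; exact Or.inl (image_blk_bs blk hsurj X).symm
    · rw [Finset.mem_inter, mem_cellBonds_iff] at hb
      exact Or.inr ⟨blk b, Finset.mem_inter.2 ⟨hb.1, Finset.mem_image_of_mem blk hb.2⟩⟩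
  · rintro (h | ⟨c, hc⟩)
    · subst h
      rcases Y.eq_empty_or_nonempty with hY | ⟨b, hb⟩
      · subst hY; exact Or.inl (by simp)
      · exact Or.inr ⟨b, Finset.mem_inter.2 ⟨(mem_cellBonds_iff blk _ b).2 (Finset.mem_image_of_mem blk hb), hb⟩⟩
    · rw [Finset.mem_inter, Finset.mem_image] at hc
      obtain ⟨hcX, b, hbY, rfl⟩ := hc
      exact Or.inr ⟨b, Finset.mem_inter.2 ⟨(mem_cellBonds_iff blk X b).2 hcX, hbY⟩⟩

omit [DecidableEq B] in
/-- A bond set is the pushforward of an atom set iff it is the pushforward of its own atoms. [folklore] -/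
theorem eq_bs_image_of_eq_bs (hsurj : Function.Surjective blk) {X : Finset β} {Y : Finset B}
    (h : Finset.univ.filter (fun b => blk b ∈ X) = Y) : Finset.univ.filter (fun b => blk b ∈ Y.image blk) = Y := by
  subst h; rw [image_blk_bs blk hsurj]

end CellMap

/-! ## §2 The partition functions agree: `Ξ_bond(w_U) = Ξ_atom(K_U)` -/

section Push

variable {P : Params} {β : Type*} [DecidableEq β] {G : Type*} (blk : PBond P 0 → β)

open Classical in
/-- ★ **`Ξ_bond(w_U) = Ξ_atom(K_U)`.**  Atom activities `K U X` on an atom family `𝒜`, a cell map `blk` hitting every atom, and bond activities `w` agreeing with `K` on the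
pushforwards `bs X` (`X ∈ 𝒜`) and vanishing on every other bond polymer: the bond-polymer partition function over ALL bond polymers (the `gasZ` of LINE g19-1∕g19-2, before
taking `Re`) equals the atom partition function over `𝒜`. [cite: KoteckyPreiss1986, (1) p.492] -/
theorem gasZ_eq_atomGas (hsurj : Function.Surjective blk) (𝒜 : Finset (Finset β))
    (K : GaugeField P 0 G → Finset β → ℝ) (w : GaugeField P 0 G → Finset (PBond P 0) → ℝ) (U : GaugeField P 0 G)
    (hwon : ∀ X ∈ 𝒜, w U (Finset.univ.filter (fun b => blk b ∈ X)) = K U X)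
    (hwoff : ∀ Y : Finset (PBond P 0), (∀ X ∈ 𝒜, Finset.univ.filter (fun b => blk b ∈ X) ≠ Y) → w U Y = 0) :
    polymerPartitionFunction polyInc (fun Y : Finset (PBond P 0) => ((w U Y : ℝ) : ℂ)) Finset.univ =
      polymerPartitionFunction polyInc (fun X : Finset β => ((K U X : ℝ) : ℂ)) 𝒜 := by
  have hsymm : ∀ Y Y' : Finset (PBond P 0), polyInc Y Y' → polyInc Y' Y := fun Y Y' h => by
    rcases h with h | h
    · exact Or.inl h.symm
    · exact Or.inr (by rwa [Finset.inter_comm])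
  -- restrict to the image family (activities vanish elsewhere)
  rw [polymerPartitionFunction_eq_of_vanish_off hsymm _ (Finset.subset_univ (𝒜.image fun X => Finset.univ.filter (fun b => blk b ∈ X))) ?_]
  · -- relabel along the injective, `polyInc`-preserving pushforward
    refine polymerPartitionFunction_image (inc := polyInc) (inc' := polyInc) ((cellBonds_injective blk hsurj).injOn) (fun X _ X' _ => polyInc_bs_iff blk hsurj X X') ?_
    intro X hX
    simp only [hwon X hX]
  · intro Y _ hY
    have : w U Y = 0 := hwoff Y fun X hX hXY => hY (Finset.mem_image.2 ⟨X, hX, hXY⟩)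
    simp [this]

/-! ## §3 `w U ∅ = 0` and V-locality of the pushed activities -/

/-- The empty bond polymer is the pushforward of the empty atom set only. [folklore] -/
theorem bs_eq_empty_iff (hsurj : Function.Surjective blk) (X : Finset β) :
    Finset.univ.filter (fun b => blk b ∈ X) = ∅ ↔ X = ∅ := by
  constructor
  · intro h
    have := congrArg (fun Y : Finset (PBond P 0) => Y.image blk) h
    simpa only [image_blk_bs blk hsurj, Finset.image_empty] using this
  · rintro rfl; simp

/-- `w U ∅ = 0` when the atom activities vanish on `∅` (or `∅ ∉ 𝒜`). [folklore] -/
theorem atomPush_empty (hsurj : Function.Surjective blk) (𝒜 : Finset (Finset β))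
    (K : GaugeField P 0 G → Finset β → ℝ) (w : GaugeField P 0 G → Finset (PBond P 0) → ℝ) (U : GaugeField P 0 G)
    (hwon : ∀ X ∈ 𝒜, w U (Finset.univ.filter (fun b => blk b ∈ X)) = K U X)
    (hwoff : ∀ Y : Finset (PBond P 0), (∀ X ∈ 𝒜, Finset.univ.filter (fun b => blk b ∈ X) ≠ Y) → w U Y = 0)
    (hK : ∅ ∈ 𝒜 → K U ∅ = 0) : w U ∅ = 0 := by
  by_cases h : ∅ ∈ 𝒜
  · have := hwon ∅ h
    rw [(bs_eq_empty_iff blk hsurj ∅).2 rfl] at this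
    rw [this, hK h]
  · exact hwoff ∅ fun X hX hXe => h ((bs_eq_empty_iff blk hsurj X).1 hXe ▸ hX)

/-- **V-locality transported**: if `K U X` depends on `U` only through the bonds of the cells of `X`, the pushed activities are V-local (the `IsLocalActivity` text).
[cite: Balaban1989LargeFieldII, (1.99) p.390] -/
theorem isLocalActivity_atomPush (𝒜 : Finset (Finset β))
    (K : GaugeField P 0 G → Finset β → ℝ) (w : GaugeField P 0 G → Finset (PBond P 0) → ℝ)
    (hKloc : ∀ (X : Finset β) (U U' : GaugeField P 0 G), (∀ b : PBond P 0, blk b ∈ X → U b = U' b) → K U X = K U' X)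
    (hwon : ∀ U, ∀ X ∈ 𝒜, w U (Finset.univ.filter (fun b => blk b ∈ X)) = K U X)
    (hwoff : ∀ U (Y : Finset (PBond P 0)), (∀ X ∈ 𝒜, Finset.univ.filter (fun b => blk b ∈ X) ≠ Y) → w U Y = 0) :
    ∀ (Y : Finset (PBond P 0)) (U U' : GaugeField P 0 G), (∀ e ∈ Y, U e = U' e) → w U Y = w U' Y := by
  intro Y U U' hUU'
  by_cases h : ∃ X ∈ 𝒜, Finset.univ.filter (fun b => blk b ∈ X) = Y
  · obtain ⟨X, hX, rfl⟩ := h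
    rw [hwon U X hX, hwon U' X hX]
    exact hKloc X U U' fun b hb => hUU' b ((mem_cellBonds_iff blk X b).2 hb)
  · push Not at h
    rw [hwoff U Y h, hwoff U' Y h]

/-! ## §4 The Kotecký–Preiss data transported: atom-level KP gas ⟹ the `KPGasOn` text on bond polymers -/

open Classical in
/-- ★★ **ATOM-LEVEL KP GAS ⟹ THE `KPGasOn` TEXT OF LINE g19-1∕g19-2, VERBATIM.**  Cell map `blk` hitting every atom; atom activities `K` on the family `𝒜` (vanishing on `∅`
if `∅ ∈ 𝒜`), V-local through their cells; bond activities `w` = the pushforward (agreeing with `K` on images of `𝒜`, zero elsewhere, for every field); on the window `W`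
a field-independent majorant `K̄ ≥ |K_U|` on `𝒜`; a size `a ≥ 0` and lengths `ℓ ≥ 0` on ALL atom sets with the CELL-DIAMETER clause (`blk b, blk b′ ∈ X ⟹
tdist(b.src, b′.src) ≤ ℓ X`); the atom-level Kotecký–Preiss inequality at rate `κ` for every atom set `X` (sum over `X′ ∈ 𝒜` equal to or meeting `X`); pinned size
`a {blk e} ≤ N`.  THEN `w` is a Kotecký–Preiss gas on `W` at rate `κ` with one-bond size `≤ N` in the bond-polymer format (witnesses: `w̄ Y := K̄ (Y.image blk)` on images and
`0` elsewhere, `a_b Y := a (Y.image blk)`, `ℓ_b Y := ℓ (Y.image blk)`). [cite: Balaban1989LargeFieldII, (1.97)-(1.100) pp.389-390; KoteckyPreiss1986, (1) p.492] -/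
theorem kpGasOn_of_atomKPGas (hsurj : Function.Surjective blk) (𝒜 : Finset (Finset β)) (W : Set (GaugeField P 0 G)) (κ N : ℝ)
    (K : GaugeField P 0 G → Finset β → ℝ) (w : GaugeField P 0 G → Finset (PBond P 0) → ℝ)
    (hK0 : ∀ U, ∅ ∈ 𝒜 → K U ∅ = 0)
    (hKloc : ∀ (X : Finset β) (U U' : GaugeField P 0 G), (∀ b : PBond P 0, blk b ∈ X → U b = U' b) → K U X = K U' X)
    (hwon : ∀ U, ∀ X ∈ 𝒜, w U (Finset.univ.filter (fun b => blk b ∈ X)) = K U X)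
    (hwoff : ∀ U (Y : Finset (PBond P 0)), (∀ X ∈ 𝒜, Finset.univ.filter (fun b => blk b ∈ X) ≠ Y) → w U Y = 0)
    (Kbar a ℓ : Finset β → ℝ)
    (hdom : ∀ U, U ∈ W → ∀ X ∈ 𝒜, |K U X| ≤ Kbar X)
    (ha : ∀ X, 0 ≤ a X) (hℓ : ∀ X, 0 ≤ ℓ X)
    (hdiam : ∀ (X : Finset β) (b b' : PBond P 0), blk b ∈ X → blk b' ∈ X → (b.src.tdist b'.src : ℝ) ≤ ℓ X)
    (hKP : ∀ X : Finset β, ∑ X' ∈ 𝒜.filter (fun X' => polyInc X' X), Kbar X' * Real.exp (a X' + κ * ℓ X') ≤ a X)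
    (hpin : ∀ e : PBond P 0, a {blk e} ≤ N) :
    ∃ (wbar a ℓ : Finset (PBond P 0) → ℝ),
      (∀ U, w U ∅ = 0) ∧
      (∀ (X : Finset (PBond P 0)) (U U' : GaugeField P 0 G), (∀ e ∈ X, U e = U' e) → w U X = w U' X) ∧
      (∀ X, 0 ≤ a X) ∧ (∀ X, 0 ≤ ℓ X) ∧
      (∀ U, U ∈ W → ∀ X, |w U X| ≤ wbar X) ∧
      (∀ X : Finset (PBond P 0), ∀ e ∈ X, ∀ e' ∈ X, (e.src.tdist e'.src : ℝ) ≤ ℓ X) ∧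
      (∀ X : Finset (PBond P 0), ∑ X' ∈ Finset.univ.filter (fun X' => polyInc X' X),
          wbar X' * Real.exp (a X' + κ * ℓ X') ≤ a X) ∧
      (∀ e : PBond P 0, a {e} ≤ N) := by
  -- witnesses
  refine ⟨fun Y => if ∃ X ∈ 𝒜, Finset.univ.filter (fun b => blk b ∈ X) = Y then Kbar (Y.image blk) else 0,
    fun Y => a (Y.image blk), fun Y => ℓ (Y.image blk),
    fun U => atomPush_empty blk hsurj 𝒜 K w U (hwon U) (hwoff U) (hK0 U),
    isLocalActivity_atomPush blk 𝒜 K w hKloc hwon hwoff,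
    fun Y => ha _, fun Y => hℓ _, ?_, ?_, ?_, ?_⟩
  · -- domination
    intro U hU Y
    dsimp only
    by_cases h : ∃ X ∈ 𝒜, Finset.univ.filter (fun b => blk b ∈ X) = Y
    · rw [if_pos h]
      obtain ⟨X, hX, rfl⟩ := h
      rw [hwon U X hX, image_blk_bs blk hsurj]
      exact hdom U hU X hX
    · rw [if_neg h]
      push Not at h
      rw [hwoff U Y h, abs_zero]
  · -- diameter through the cells
    intro Y e he e' he'
    dsimp only
    exact hdiam (Y.image blk) e e' (Finset.mem_image_of_mem blk he) (Finset.mem_image_of_mem blk he')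
  · -- the KP inequality: rewrite the bond sum as the atom sum over `X′ ∈ 𝒜` meeting `Y.image blk`
    intro Y
    dsimp only
    have hterm : ∀ X' : Finset (PBond P 0),
        (if ∃ X ∈ 𝒜, Finset.univ.filter (fun b => blk b ∈ X) = X' then Kbar (X'.image blk) else 0) *
            Real.exp (a (X'.image blk) + κ * ℓ (X'.image blk)) =
          ∑ X ∈ 𝒜, if Finset.univ.filter (fun b => blk b ∈ X) = X' then Kbar X * Real.exp (a X + κ * ℓ X) else 0 := by
      intro X'
      by_cases h : ∃ X ∈ 𝒜, Finset.univ.filter (fun b => blk b ∈ X) = X'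
      · rw [if_pos h]
        obtain ⟨X, hX, rfl⟩ := h
        rw [image_blk_bs blk hsurj, Finset.sum_eq_single_of_mem X hX]
        · rw [if_pos rfl]
        · intro X₁ _ hne
          rw [if_neg (fun hEq => hne (cellBonds_injective blk hsurj hEq))]
      · rw [if_neg h, zero_mul]
        refine (Finset.sum_eq_zero fun X hX => ?_).symm
        rw [if_neg (fun hEq => h ⟨X, hX, hEq⟩)]
    simp_rw [hterm]
    rw [Finset.sum_comm]
    have hinner : ∀ X ∈ 𝒜, (∑ X' ∈ Finset.univ.filter (fun X' => polyInc X' Y),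
        if Finset.univ.filter (fun b => blk b ∈ X) = X' then Kbar X * Real.exp (a X + κ * ℓ X) else 0) =
        if polyInc X (Y.image blk) then Kbar X * Real.exp (a X + κ * ℓ X) else 0 := by
      intro X _
      rw [Finset.sum_ite_eq]
      refine if_congr ?_ rfl rfl
      rw [Finset.mem_filter, and_iff_right (Finset.mem_univ _)]
      exact polyInc_bs_left_iff blk hsurj X Y
    rw [Finset.sum_congr rfl hinner, ← Finset.sum_filter]
    exact hKP (Y.image blk)
  · -- pinned size
    intro e
    dsimp only
    rw [Finset.image_singleton]
    exact hpin e

end Push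

end Summit.QuantumFields.YangMills.Theorems.LoopLedgerGasOfAtomGas

end
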